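import Literature.AlgebraicGeometry.Motives.UniversalHypersurfaceSmooth
import Literature.AlgebraicGeometry.Motives.SmoothHypersurfaceExistenceProofs
import Literature.AlgebraicGeometry.Motives.NonsingularFormIrreducible
import Literature.AlgebraicGeometry.Motives.ReducedClosedSubschemeIso
import Literature.AlgebraicGeometry.Motives.CurveNet
import HarnessLib

/-!
# The fibres of the universal family of smooth hypersurfaces

Family `hodge`, layer `Literature/AlgebraicGeometry/Motives`. Companion (theorems only) of
`Motives/UniversalHypersurfaceFamily`, announced there: for the universal smooth hypersurface
`π : 𝒴_U → U` of degree `d` in `ℙⁿ⁺¹` (Voisin, *Hodge Theory II*, §6.2.1) over a field `k`,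

* `isNonsingularForm_pointForm` — the form `F_s` of a point `s ∈ U(K)` is nonsingular
  (`SmoothHypersurface.IsNonsingularForm`, the hypothesis of the projective Jacobian criterion,
  Hartshorne I Ex. 5.8): this is the definition of `U` as the complement of the discriminant, read
  through the base change `ℙⁿ⁺¹_K = ℙⁿ⁺¹_R ×_R K` (`ProjBaseChangeRing.isPullback_projMap'`);
  conversely `exists_point_of_isNonsingularForm`: every nonsingular form of degree `d` over `k` is
  `F_s` for a (unique, `pointForm_injective`) point `s ∈ U(k)`;
* `isPullback_fiberOver_family` — the fibre `𝒴_s = π⁻¹(s)` over `s ∈ U(k)` is a closed subscheme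
  of `ℙⁿ⁺¹_k` with support `V₊(F_s)` (the fibre square pasted from Mathlib's
  `isPullback_morphismRestrict` and the base change of `ℙⁿ⁺¹`);
* `nonempty_fiberOver_iso_hypersurface` — **`𝒴_s ≅ X_{F_s}`**, the reduced hypersurface
  `Motives.SmoothHypersurface.hypersurface F_s` (both are reduced closed subschemes of `ℙⁿ⁺¹_k` —
  the fibre because it is smooth over `k`, Stacks 056T — with the same support; Hartshorne II
  Example 3.2.6, `Motives/ReducedClosedSubschemeIso`);
* `isSmoothProjective_fiberOver_family`, **`isSmoothProjectiveFamily_family`** — for `n ≥ 1`,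
  `d ≥ 1` the universal family is a smooth projective family of relative dimension `n`
  (`Motives.IsSmoothProjectiveFamily`: smooth of relative dimension `n` by the Jacobian criterion
  in families, `Motives/UniversalHypersurfaceSmooth`; proper; every rational fibre a smooth
  projective geometrically irreducible `n`-fold, by the isomorphism with `X_{F_s}`,
  `SmoothHypersurface.isSmoothHypersurface_hypersurface` and irreducibility of nonsingular forms in
  `≥ 3` variables, `Motives/NonsingularFormIrreducible`). This is the field
  `GeometricVHSData.isSmoothProjectiveFamily` of any geometric variation of Hodge structure on the
  universal family (Voisin II §6.2.1; Hartshorne III §10).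

Everything is proved; no named facts.

## References

* C. Voisin, *Hodge Theory and Complex Algebraic Geometry II* (2003), §6.2.1 (p. 162).
  [VoisinHodgeII2003]
* R. Hartshorne, *Algebraic Geometry* (1977): I Ex. 5.8, II Example 3.2.6, III §10 (Thm. 10.2).
  [Hartshorne1977]
* The Stacks Project, Tag 056T. [StacksProject]
-/

noncomputable section

open CategoryTheory AlgebraicGeometry MvPolynomial Limits

universe u

namespace Literature.AlgebraicGeometry.Motives

/-! ### Nonsingularity is insensitive to extension of scalars -/

namespace SmoothHypersurface

/-- Nonsingularity of a form is preserved under any extension of scalars `φ : k → K`: a prime of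
`K[x]` containing `F_K` and its partials contracts to a prime of `k[x]` containing `F` and its
partials (`∂ⱼ(F_K) = (∂ⱼF)_K`, Mathlib `pderiv_map`). [folklore] -/
theorem IsNonsingularForm.map {k K : Type*} [CommRing k] [CommRing K] (φ : k →+* K) {n : ℕ}
    {F : MvPolynomial (Fin (n + 2)) k} (hF : IsNonsingularForm k F) :
    IsNonsingularForm K (MvPolynomial.map φ F) := by
  intro 𝔓 h𝔓 hF𝔓 hder i
  have h := hF (𝔓.comap (MvPolynomial.map φ)) (h𝔓.comap _) hF𝔓 (fun j => ?_) i
  · simpa [Ideal.mem_comap] using h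
  · change MvPolynomial.map φ (pderiv j F) ∈ 𝔓
    rw [← pderiv_map]
    exact hder j

end SmoothHypersurface

namespace UniversalHypersurface

attribute [local instance] MvPolynomial.gradedAlgebra ProjBaseChange.algebraBase
  ProjBaseChange.isScalarTower_localization

section Points

variable (k : Type u) [Field k] (n d : ℕ) {K : Type u} [Field K] [Algebra k K]

/-- graded pieces of `R[x₀, …, x_{n+1}]` -/
local notation "𝒜" R => MvPolynomial.homogeneousSubmodule (Fin (n + 2)) R

/-- The base change `ℙⁿ⁺¹_K → ℙⁿ⁺¹_R` along the coefficient homomorphism `R → K` of a `K`-point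
`s` of `U` (Mathlib `Proj.map` of `R[x] → K[x]`). [folklore] -/
def projMapPoint (s : AlgPoints (base k n d) K) : projSp n K ⟶ projSp n (CoeffRing k n d) :=
  letI : Algebra (CoeffRing k n d) K := (pointHom k n d s).hom.toAlgebra
  Proj.map (ProjBaseChangeRing.mapGraded (CoeffRing k n d) K (Fin (n + 2)))
    (ProjBaseChangeRing.irrelevant_le_map (CoeffRing k n d) K (Fin (n + 2)))

/-- **`ℙⁿ⁺¹_K = ℙⁿ⁺¹_R ×_{S^d} Spec K` over the point `s`** (`ProjBaseChangeRing.isPullback_projMap'`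
for the algebra `R → K` of `s`; Liu, Prop. 3.1.9). [folklore] -/
theorem isPullback_projMapPoint (s : AlgPoints (base k n d) K) :
    IsPullback (projMapPoint k n d s) (projSpToSpec n K) (projSpToSpec n (CoeffRing k n d))
      (Spec.map (pointHom k n d s)) := by
  letI : Algebra (CoeffRing k n d) K := (pointHom k n d s).hom.toAlgebra
  exact ProjBaseChangeRing.isPullback_projMap' (CoeffRing k n d) K

/-- On points, `projMapPoint s` is contraction of homogeneous primes along `R[x] → K[x]`:
`G ∈ 𝔭_{image}` iff `G_s ∈ 𝔭` (by definition of Mathlib `Proj.map`). [folklore] -/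
theorem mem_projMapPoint_apply_iff (s : AlgPoints (base k n d) K) (q : projSp n K)
    (G : MvPolynomial (Fin (n + 2)) (CoeffRing k n d)) :
    G ∈ (projMapPoint k n d s q).asHomogeneousIdeal ↔
      MvPolynomial.map (pointHom k n d s).hom G ∈ q.asHomogeneousIdeal :=
  Iff.rfl

/-- **The form of a point of `U` is nonsingular** (definition of `U = S^d ∖ discriminant`, Voisin
II §6.2.1, and the Jacobian criterion I Ex. 5.8): a prime of `K[x]` containing `F_s` and all
`∂ⱼF_s` but missing a variable would give — through its homogeneous core and `ℙⁿ⁺¹_K → ℙⁿ⁺¹_R` — a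
point of the singular set `V₊(F, ∂F)` over `s`. [cite: VoisinHodgeII2003, §6.2.1] -/
theorem isNonsingularForm_pointForm (s : AlgPoints (base k n d) K) :
    SmoothHypersurface.IsNonsingularForm K (pointForm k n d s) := by
  intro 𝔭 h𝔭 hF hder
  by_contra hX
  push Not at hX
  obtain ⟨i₀, hi₀⟩ := hX
  -- the homogeneous core of `𝔭` is a relevant homogeneous prime containing `F_s` and the `∂ⱼ F_s`
  have hcore : (𝔭.homogeneousCore (𝒜 K)).toIdeal ≤ 𝔭 := Ideal.toIdeal_homogeneousCore_le _ _
  let q : projSp n K :=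
    ⟨𝔭.homogeneousCore (𝒜 K), h𝔭.homogeneousCore, fun hle =>
      hi₀ (hcore (hle (HomogeneousIdeal.mem_irrelevant_of_mem _ one_pos (isHomogeneous_X K i₀))))⟩
  have hFq : pointForm k n d s ∈ q.asHomogeneousIdeal :=
    Ideal.mem_homogeneousCore_of_homogeneous_of_mem ⟨d, isHomogeneous_pointForm k n d s⟩ hF
  have hderq : ∀ j, pderiv j (pointForm k n d s) ∈ q.asHomogeneousIdeal := fun j =>
    Ideal.mem_homogeneousCore_of_homogeneous_of_mem ⟨d - 1, (isHomogeneous_pointForm k n d s).pderiv⟩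
      (hder j)
  -- its image in `ℙⁿ⁺¹_R` lies in the singular set …
  have hmem : projMapPoint k n d s q ∈ singularSet k n d := by
    change (insert (universalForm k n d) (Set.range fun j => pderiv j (universalForm k n d)) :
        Set (MvPolynomial (Fin (n + 2)) (CoeffRing k n d))) ⊆ _
    rw [Set.insert_subset_iff, Set.range_subset_iff]
    refine ⟨(mem_projMapPoint_apply_iff k n d s q _).mpr hFq, fun j => ?_⟩
    rw [SetLike.mem_coe, mem_projMapPoint_apply_iff, ← pderiv_map]
    exact hderq j
  -- … and over the point `s ∈ U`, contradicting the definition of `U`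
  have hpt : projSpToSpec n (CoeffRing k n d) (projMapPoint k n d s q) ∈ baseOpens k n d := by
    have h1 : (projMapPoint k n d s ≫ projSpToSpec n (CoeffRing k n d)) q =
        (baseOpens k n d).ι (s.left (projSpToSpec n K q)) := by
      rw [(isPullback_projMapPoint k n d s).w, Spec_map_pointHom]
      rfl
    rw [Scheme.Hom.comp_apply] at h1
    rw [h1, Scheme.Opens.ι_apply]
    exact Subtype.prop _
  exact (mem_baseOpens_iff k n d _).mp hpt ⟨_, hmem, rfl⟩

/-- `X_{F_s}` is a smooth projective geometrically irreducible `n`-fold for every point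
`s ∈ U(K)`, `n ≥ 1`, `d ≥ 1` (`SmoothHypersurface.isSmoothHypersurface_hypersurface`: Jacobian
criterion, Hartshorne I Ex. 5.8 / III 10.0.3, and irreducibility of nonsingular forms in `≥ 3`
variables over every overfield, `IsNonsingularForm.irreducible`). [cite: Hartshorne1977, I Ex. 5.8 and III Example 10.0.3] -/
theorem isSmoothProjective_hypersurface_pointForm (hn : 1 ≤ n) (hd : 1 ≤ d)
    (s : AlgPoints (base k n d) K) :
    IsSmoothProjective n (SmoothHypersurface.hypersurface (pointForm k n d s)) :=
  (SmoothHypersurface.isSmoothHypersurface_hypersurface (pointForm k n d s)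
    (isHomogeneous_pointForm k n d s) hd (isNonsingularForm_pointForm k n d s)
    (fun L _ _ => ((isNonsingularForm_pointForm k n d s).map (algebraMap K L)).irreducible hn hd
      ((isHomogeneous_pointForm k n d s).map _))).1

end Points

/-! ### The fibre of the universal family over a rational point of `U` -/

section Fibre

variable (k : Type u) [Field k] (n d : ℕ) (s : AlgPoints (base k n d) k)

/-- graded pieces of `R[x₀, …, x_{n+1}]` -/
local notation "𝒜" R => MvPolynomial.homogeneousSubmodule (Fin (n + 2)) R

/-- **The fibre square**: `𝒴_s = π⁻¹(s) ⟶ 𝒴_U ⟶ 𝒴` over `Spec k → U ⊆ S^d` is cartesian, i.e.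
`𝒴_s = 𝒴 ×_{S^d} Spec k` along the point `s` (the fibre square of `π` pasted with Mathlib's
`isPullback_morphismRestrict`; Hartshorne II.3, fibres). [folklore] -/
theorem isPullback_fiberOver_totalToSpec :
    IsPullback (pullback.fst (family k n d).left s.left ≫ ((totalToSpec k n d) ⁻¹ᵁ (baseOpens k n d)).ι)
      (pullback.snd (family k n d).left s.left) (totalToSpec k n d) (Spec.map (pointHom k n d s)) := by
  rw [Spec_map_pointHom]
  exact (IsPullback.of_hasPullback (family k n d).left s.left).paste_horiz
    (isPullback_morphismRestrict (totalToSpec k n d) (baseOpens k n d)).flip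

/-- **The embedding `𝒴_s ⟶ ℙⁿ⁺¹_k` of the fibre** over `s ∈ U(k)`: the morphism to
`ℙⁿ⁺¹_k = ℙⁿ⁺¹_R ×_{S^d} Spec k` with components `𝒴_s → 𝒴 ↪ ℙⁿ⁺¹_R` and `𝒴_s → Spec k`. [folklore] -/
def fiberEmb : pullback (family k n d).left s.left ⟶ projSp n k :=
  (isPullback_projMapPoint k n d s).lift
    (pullback.fst (family k n d).left s.left ≫ ((totalToSpec k n d) ⁻¹ᵁ (baseOpens k n d)).ι ≫
      totalι k n d)
    (pullback.snd (family k n d).left s.left)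
    (by
      have w := (isPullback_fiberOver_totalToSpec k n d s).w
      rw [Category.assoc] at w
      rw [Category.assoc, Category.assoc]
      exact w)

/-- `fiberEmb` followed by `ℙⁿ⁺¹_k → ℙⁿ⁺¹_R` is `𝒴_s → 𝒴 ↪ ℙⁿ⁺¹_R`. [folklore] -/
@[reassoc]
theorem fiberEmb_comp_projMapPoint :
    fiberEmb k n d s ≫ projMapPoint k n d s =
      pullback.fst (family k n d).left s.left ≫ ((totalToSpec k n d) ⁻¹ᵁ (baseOpens k n d)).ι ≫
        totalι k n d :=
  IsPullback.lift_fst _ _ _ _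

/-- `fiberEmb` followed by `ℙⁿ⁺¹_k → Spec k` is the structure morphism `𝒴_s → Spec k`. [folklore] -/
@[reassoc]
theorem fiberEmb_comp_projSpToSpec :
    fiberEmb k n d s ≫ projSpToSpec n k = pullback.snd (family k n d).left s.left :=
  IsPullback.lift_snd _ _ _ _

/-- **`𝒴_s ⊆ ℙⁿ⁺¹_k` is the base change of `𝒴 ⊆ ℙⁿ⁺¹_R`** along `ℙⁿ⁺¹_k → ℙⁿ⁺¹_R` (the fibre
square over `S^d` factored through the cartesian square `ℙⁿ⁺¹_k = ℙⁿ⁺¹_R ×_{S^d} Spec k`). [folklore] -/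
theorem isPullback_fiberEmb :
    IsPullback (pullback.fst (family k n d).left s.left ≫ ((totalToSpec k n d) ⁻¹ᵁ (baseOpens k n d)).ι)
      (fiberEmb k n d s) (totalι k n d) (projMapPoint k n d s) := by
  refine IsPullback.of_bot ?_ (fiberEmb_comp_projMapPoint k n d s).symm
    (isPullback_projMapPoint k n d s)
  rw [fiberEmb_comp_projSpToSpec]
  exact isPullback_fiberOver_totalToSpec k n d s

/-- `𝒴_s ⟶ ℙⁿ⁺¹_k` is a closed immersion (base change of `𝒴 ↪ ℙⁿ⁺¹_R`). [folklore] -/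
instance isClosedImmersion_fiberEmb : IsClosedImmersion (fiberEmb k n d s) :=
  MorphismProperty.of_isPullback (P := @IsClosedImmersion) (isPullback_fiberEmb k n d s)
    inferInstance

/-- **The fibre `𝒴_s` has support `V₊(F_s) ⊆ ℙⁿ⁺¹_k`**: the image of `𝒴_s ⟶ ℙⁿ⁺¹_k` is the
preimage of `V₊(F) ⊆ ℙⁿ⁺¹_R`, i.e. the zero locus of the specialised form. [folklore] -/
theorem range_fiberEmb :
    Set.range (fiberEmb k n d s) = ProjectiveSpectrum.zeroLocus (𝒜 k) {pointForm k n d s} := by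
  have h := isPullback_fiberEmb k n d s
  have hsurj : Function.Surjective h.isoPullback.hom := h.isoPullback.hom.homeomorph.surjective
  have hr : Set.range (fiberEmb k n d s) =
      Set.range (pullback.snd (totalι k n d) (projMapPoint k n d s)) := by
    rw [← h.isoPullback_hom_snd]
    ext y
    simp only [Set.mem_range]
    constructor
    · rintro ⟨x, rfl⟩
      exact ⟨_, rfl⟩
    · rintro ⟨x, rfl⟩
      obtain ⟨x', rfl⟩ := hsurj x
      exact ⟨x', rfl⟩
  rw [hr, Scheme.Pullback.range_snd, range_totalι]
  ext x
  change ({universalForm k n d} : Set _) ⊆ _ ↔ ({pointForm k n d s} : Set _) ⊆ _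
  rw [Set.singleton_subset_iff, Set.singleton_subset_iff, SetLike.mem_coe, SetLike.mem_coe]
  exact mem_projMapPoint_apply_iff k n d s x _

/-- The fibre `𝒴_s → Spec k` is smooth of relative dimension `n` for `d ≥ 1` (base change of
`π`, `smoothOfRelativeDimension_family_left`; Hartshorne III Thm. 10.2). [cite: Hartshorne1977, III Thm. 10.2] -/
theorem smoothOfRelativeDimension_fiber_snd (hd : 0 < d) :
    SmoothOfRelativeDimension n (pullback.snd (family k n d).left s.left) :=
  haveI := smoothOfRelativeDimension_isStableUnderBaseChange (n := n)
  MorphismProperty.pullback_snd (P := @SmoothOfRelativeDimension n) _ _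
    (smoothOfRelativeDimension_family_left k n d hd)

/-- The fibre `𝒴_s` is reduced for `d ≥ 1` (smooth over a field; Stacks 056T,
`isReduced_of_smoothOfRelativeDimension`). [cite: StacksProject, Tag 056T] -/
theorem isReduced_fiber (hd : 0 < d) : IsReduced (pullback (family k n d).left s.left) :=
  @isReduced_of_smoothOfRelativeDimension k _ _ (pullback.snd (family k n d).left s.left) n
    (smoothOfRelativeDimension_fiber_snd k n d s hd)

/-- **The fibre of the universal family over `s ∈ U(k)` is the hypersurface `X_{F_s}`**
(`Motives.SmoothHypersurface.hypersurface`, the reduced induced structure on `V₊(F_s)`), as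
`k`-schemes: both are reduced closed subschemes of `ℙⁿ⁺¹_k` with support `V₊(F_s)` (Hartshorne II
Example 3.2.6, uniqueness of the reduced induced structure; `d ≥ 1`). This is the statement "the
fibre of the universal smooth hypersurface `π : 𝒴 → B` over `f ∈ B` is `Y_f = {f = 0}`" of Voisin
II, §6.2.1. [cite: VoisinHodgeII2003, §6.2.1] -/
theorem nonempty_fiberOver_iso_hypersurface (hd : 0 < d) :
    Nonempty (fiberOver (family k n d) s ≅ SmoothHypersurface.hypersurface (pointForm k n d s)) := by
  haveI := isReduced_fiber k n d s hd
  haveI := SmoothHypersurface.isReduced_hypersurface (pointForm k n d s)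
    (isHomogeneous_pointForm k n d s) (isNonsingularForm_pointForm k n d s) hd
  -- the closed immersion `X_{F_s} ↪ ℙⁿ⁺¹_k` (its codomain is `projSp n k` only up to unfolding
  -- `projectiveSpace`, which instance search does not do: name it at that type)
  let ι' : (SmoothHypersurface.hypersurface (pointForm k n d s)).left ⟶ projSp n k :=
    (SmoothHypersurface.hypersurfaceι (pointForm k n d s)).left
  haveI : IsClosedImmersion ι' := SmoothHypersurface.isClosedImmersion_hypersurfaceι_left _
  obtain ⟨e, he⟩ := exists_iso_of_isClosedImmersion_of_range_eq ι' (fiberEmb k n d s)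
    ((SmoothHypersurface.range_hypersurfaceι _).trans (range_fiberEmb k n d s).symm)
  refine ⟨Over.isoMk e ?_⟩
  have h2 : e.hom ≫ (SmoothHypersurface.hypersurface (pointForm k n d s)).hom =
      pullback.snd (family k n d).left s.left := by
    rw [← fiberEmb_comp_projSpToSpec k n d s, ← he, Category.assoc]
    rfl
  have h3 : (specOver k k).hom = 𝟙 _ := by
    change Spec.map (CommRingCat.ofHom (RingHom.id k)) = _
    exact Spec.map_id _
  have h4 : (fiberOver (family k n d) s).hom = pullback.snd (family k n d).left s.left := by
    rw [fiberOver_hom, h3]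
    exact Category.comp_id _
  exact h2.trans h4.symm

/-- **The rational fibres of the universal family are smooth projective geometrically irreducible
`n`-folds** (`n ≥ 1`, `d ≥ 1`): transport of `isSmoothProjective_hypersurface_pointForm` along
`𝒴_s ≅ X_{F_s}`. [cite: VoisinHodgeII2003, §6.2.1] -/
theorem isSmoothProjective_fiberOver_family (hn : 1 ≤ n) (hd : 1 ≤ d) :
    IsSmoothProjective n (fiberOver (family k n d) s) :=
  (isSmoothProjective_hypersurface_pointForm k n d hn hd s).of_iso
    (nonempty_fiberOver_iso_hypersurface k n d s hd).some.symm

end Fibre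

/-! ### Every nonsingular form is a fibre -/

section OfForm

variable (k : Type u) [Field k] (n d : ℕ)

/-- **The point `[G] ∈ S^d(k)` of a nonsingular form `G` lies in `U`**: a point of the singular set
`V₊(F, ∂F) ⊆ ℙⁿ⁺¹_R` over `[G]` would lift to `ℙⁿ⁺¹_k = ℙⁿ⁺¹_R ×_{S^d} Spec k` (surjectivity of
fibre products on points, Mathlib `Scheme.Pullback.exists_preimage_pullback`), i.e. to a relevant
homogeneous prime of `k[x]` containing `G` and all `∂ⱼG` — excluded by nonsingularity
(Hartshorne I Ex. 5.8). [cite: Hartshorne1977, I Ex. 5.8] -/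
theorem specMap_coeffHom_apply_mem_baseOpens {G : MvPolynomial (Fin (n + 2)) k}
    (hG : G.IsHomogeneous d) (hJ : SmoothHypersurface.IsNonsingularForm k G) (y : Spec (.of k)) :
    Spec.map (CommRingCat.ofHom (coeffHom k n d G).toRingHom) y ∈ baseOpens k n d := by
  letI : Algebra (CoeffRing k n d) k := (coeffHom k n d G).toRingHom.toAlgebra
  have sq : IsPullback
      (Proj.map (ProjBaseChangeRing.mapGraded (CoeffRing k n d) k (Fin (n + 2)))
        (ProjBaseChangeRing.irrelevant_le_map (CoeffRing k n d) k (Fin (n + 2))))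
      (projSpToSpec n k) (projSpToSpec n (CoeffRing k n d))
      (Spec.map (CommRingCat.ofHom (coeffHom k n d G).toRingHom)) :=
    ProjBaseChangeRing.isPullback_projMap' (CoeffRing k n d) k
  rw [mem_baseOpens_iff]
  rintro ⟨p, hp, hpy⟩
  obtain ⟨z, hz, -⟩ := Scheme.Pullback.exists_preimage_pullback (f := projSpToSpec n (CoeffRing k n d))
    (g := Spec.map (CommRingCat.ofHom (coeffHom k n d G).toRingHom)) p y hpy
  -- the lift `q ∈ ℙⁿ⁺¹_k` of `p`
  set q := sq.isoPullback.inv z with hqdef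
  have hq : Proj.map _ (ProjBaseChangeRing.irrelevant_le_map (CoeffRing k n d) k (Fin (n + 2))) q =
      p := by
    rw [← hz, hqdef, ← Scheme.Hom.comp_apply, sq.isoPullback_inv_fst]
  have key : ∀ H : MvPolynomial (Fin (n + 2)) (CoeffRing k n d), H ∈ p.asHomogeneousIdeal ↔
      MvPolynomial.map (coeffHom k n d G).toRingHom H ∈ q.asHomogeneousIdeal := fun H => by
    rw [← hq]
    exact Iff.rfl
  have hp' : (insert (universalForm k n d) (Set.range fun j => pderiv j (universalForm k n d)) :
      Set (MvPolynomial (Fin (n + 2)) (CoeffRing k n d))) ⊆ p.asHomogeneousIdeal := hp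
  rw [Set.insert_subset_iff, Set.range_subset_iff] at hp'
  have hGq : G ∈ q.asHomogeneousIdeal := by
    have h := (key _).mp hp'.1
    rwa [map_coeffHom_universalForm k n d G hG] at h
  have hder : ∀ j, pderiv j G ∈ q.asHomogeneousIdeal := fun j => by
    have h := (key _).mp (hp'.2 j)
    rwa [← pderiv_map, map_coeffHom_universalForm k n d G hG] at h
  have hall := hJ _ q.isPrime hGq hder
  refine q.not_irrelevant_le fun a ha => ?_
  exact Ideal.span_le.mpr (Set.range_subset_iff.mpr hall)
    (ProjBaseChangeRing.irrelevant_le_span_X k ha)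

/-- The morphism `Spec k → U` of a nonsingular form `G` of degree `d`: the `k`-point `[G]` of `S^d`,
`a_m ↦ coeff_m G`, lifted through the open immersion `U ⊆ S^d` (Mathlib `IsOpenImmersion.lift`).
[folklore] -/
def pointOfFormHom {G : MvPolynomial (Fin (n + 2)) k} (hG : G.IsHomogeneous d)
    (hJ : SmoothHypersurface.IsNonsingularForm k G) : Spec (.of k) ⟶ (baseOpens k n d).toScheme :=
  IsOpenImmersion.lift (baseOpens k n d).ι
    (Spec.map (CommRingCat.ofHom (coeffHom k n d G).toRingHom))
    (by
      rintro _ ⟨y, rfl⟩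
      rw [Scheme.Opens.range_ι]
      exact specMap_coeffHom_apply_mem_baseOpens k n d hG hJ y)

/-- `pointOfFormHom` followed by `U ⊆ S^d` is the point `[G]` of `S^d`. [folklore] -/
@[reassoc]
theorem pointOfFormHom_ι {G : MvPolynomial (Fin (n + 2)) k} (hG : G.IsHomogeneous d)
    (hJ : SmoothHypersurface.IsNonsingularForm k G) :
    pointOfFormHom k n d hG hJ ≫ (baseOpens k n d).ι =
      Spec.map (CommRingCat.ofHom (coeffHom k n d G).toRingHom) :=
  IsOpenImmersion.lift_fac _ _ _

/-- **The point `[G] ∈ U(k)` of a nonsingular form `G` of degree `d`** as a `k`-point of the base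
of the universal family (Voisin II, §6.2.1: `f ∈ B`). [cite: VoisinHodgeII2003, §6.2.1] -/
def pointOfForm {G : MvPolynomial (Fin (n + 2)) k} (hG : G.IsHomogeneous d)
    (hJ : SmoothHypersurface.IsNonsingularForm k G) : AlgPoints (base k n d) k :=
  AlgPoints.mk (X := base k n d) (pointOfFormHom k n d hG hJ)
    (by
      have hc : (coeffHom k n d G).toRingHom.comp (algebraMap k (CoeffRing k n d)) =
          algebraMap k k :=
        RingHom.ext fun r => (coeffHom k n d G).commutes r
      change (pointOfFormHom k n d hG hJ ≫ (baseOpens k n d).ι) ≫ specCoeffToSpec k n d = _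
      rw [pointOfFormHom_ι, ← Spec.map_comp, ← CommRingCat.ofHom_comp, hc])

/-- The coefficient homomorphism of `[G]` is `a_m ↦ coeff_m G`. [folklore] -/
theorem pointHom_pointOfForm {G : MvPolynomial (Fin (n + 2)) k} (hG : G.IsHomogeneous d)
    (hJ : SmoothHypersurface.IsNonsingularForm k G) :
    pointHom k n d (pointOfForm k n d hG hJ) = CommRingCat.ofHom (coeffHom k n d G).toRingHom := by
  apply Spec.map_injective
  rw [Spec_map_pointHom]
  exact pointOfFormHom_ι k n d hG hJ

/-- The form of the point `[G]` is `G`. [folklore] -/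
theorem pointForm_pointOfForm {G : MvPolynomial (Fin (n + 2)) k} (hG : G.IsHomogeneous d)
    (hJ : SmoothHypersurface.IsNonsingularForm k G) :
    pointForm k n d (pointOfForm k n d hG hJ) = G := by
  rw [pointForm, pointHom_pointOfForm, CommRingCat.hom_ofHom]
  exact map_coeffHom_universalForm k n d G hG

/-- **Every nonsingular form of degree `d` over `k` is the form of a (unique, `pointForm_injective`)
point of `U(k)`** (Voisin II, §6.2.1: `B` is the set of `f` with `Y_f` smooth). [cite: VoisinHodgeII2003, §6.2.1] -/
theorem exists_point_of_isNonsingularForm {G : MvPolynomial (Fin (n + 2)) k}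
    (hG : G.IsHomogeneous d) (hJ : SmoothHypersurface.IsNonsingularForm k G) :
    ∃ s : AlgPoints (base k n d) k, pointForm k n d s = G :=
  ⟨pointOfForm k n d hG hJ, pointForm_pointOfForm k n d hG hJ⟩

/-- Hence **every smooth hypersurface `X_G`, `G` nonsingular of degree `d ≥ 1`, is a fibre of the
universal family**: `𝒴_{[G]} ≅ X_G` over `k`. [cite: VoisinHodgeII2003, §6.2.1] -/
theorem exists_fiberOver_iso_hypersurface (hd : 0 < d) {G : MvPolynomial (Fin (n + 2)) k}
    (hG : G.IsHomogeneous d) (hJ : SmoothHypersurface.IsNonsingularForm k G) :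
    ∃ s : AlgPoints (base k n d) k,
      Nonempty (fiberOver (family k n d) s ≅ SmoothHypersurface.hypersurface G) := by
  obtain ⟨s, hs⟩ := exists_point_of_isNonsingularForm k n d hG hJ
  subst hs
  exact ⟨s, nonempty_fiberOver_iso_hypersurface k n d s hd⟩

end OfForm

/-- **The universal family of smooth hypersurfaces of degree `d ≥ 1` in `ℙⁿ⁺¹`, `n ≥ 1`, is a
smooth projective family of relative dimension `n`** (`Motives.IsSmoothProjectiveFamily`): smooth
of relative dimension `n` (Jacobian criterion in families, `Motives/UniversalHypersurfaceSmooth`),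
proper, and every rational fibre `𝒴_s ≅ X_{F_s}` a smooth projective geometrically irreducible
`n`-fold. This is "the universal smooth hypersurface `π : 𝒴 → B`" of Voisin II, §6.2.1 as a smooth
projective family in the sense of Voisin I, §9.1.1 / Hartshorne III §10 — the field
`GeometricVHSData.isSmoothProjectiveFamily` of every geometric variation of Hodge structure on it.
[cite: VoisinHodgeII2003, §6.2.1] -/
theorem isSmoothProjectiveFamily_family (k : Type u) [Field k] {n d : ℕ} (hn : 1 ≤ n)
    (hd : 1 ≤ d) : IsSmoothProjectiveFamily (family k n d) n where
  smoothOfRelativeDimension := smoothOfRelativeDimension_family_left k n d hd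
  isProper := by
    show IsProper (familyHom k n d)
    infer_instance
  isSmoothProjective s := isSmoothProjective_fiberOver_family k n d s hn hd

end UniversalHypersurface

end Literature.AlgebraicGeometry.Motives

end
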